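import Summits.BirchSwinnertonDyer.BirchSwinnertonDyer.Theorems.SmallImageMuTransferMuTransferX9KolyvaginClassTwist
import HarnessLib

/-!
# Route ByReductionTypeAtTwo, crux `OrdKatoHalfAtTwoIso` (stmt-BirchSwinnertonDyer-19573), line `steinberg-fibre-at-two`
# (skeleton v11), stub `stub_coreA_posDisc : CoreTheoremAPosDiscTwo` (the core Theorem A at `2` on `0 < Δ`): plan item (P2)
# of the lead's `STUB-BRIEF-stub_coreA_posDisc.md` — THE KOLYVAGIN COCYCLE VANISHES AT EVERY INVOLUTION OUTSIDE `N`
# ACTING TRIVIALLY ON THE COEFFICIENTS, WHEN `4 ∣ [G : N]` (generic continuous `H¹`, cocycle level, curve-free)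

Seat `cruxlead-stmt-BirchSwinnertonDyer-19573-w2` (prover WIDTH under the lead `cruxlead-19573`; HOME
`run/shared/lean/pub/bsd-2adic/`; `--supports` the crux-202 child `OrdKatoIntSurjectiveAtTwo` = CoreA⁺ after P7). THEOREMS
ONLY (no definition, no named fact, no `sorry`, no instance). HONEST FRAMING (cell bsd-2adic): BSD is not proved by any of
this; the crux is not proved; the stub `CoreTheoremAPosDiscTwo` (p684479) is NOT proved here. This file is the algebraic
heart of the brief's (P2) «the real component of the Kolyvagin cocycle VANISHES for Kolyvagin primes `q ≡ 1 (mod 4)`»,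
done at COCYCLE level in the generic setting of `KolyvaginTwist.exists_kolyvaginCocycle`
(`…SmallImageMuTransferMuTransferX9KolyvaginClassTwist.lean`, MU-TRANSFER-PROOF §3 Lemma 2) — no corestriction, no
inflation–restriction, no Mackey formula is needed.

## Mathematics

Setting of Lemma 2: `N ⊴ G`, `X` a representation of `G` on which `σ ∈ G` acts trivially, `σ^n ∈ N`, the powers `σ^i`
(`i < n`) a system of representatives of `G ⧸ N` (`hcov`, `hinj`), `y` a cocycle on `N` with `y(σ^n) = 0`, and `Φ` a global
cocycle extending the derivative cocycle: `Φ(u) = Σ_{i<n} i • σ^i y(σ^{-i} u σ^i)` on `N` (`hΦN`). Let `c ∈ G ∖ N` be an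
involution (`c² = 1`) acting trivially on `X`, and suppose `2·X = 0` (the `p = 2` coefficients `𝒯_J(E)`).

* (§2, the index) `c ∈ σ^k N` with `2k = n`: write `c = σ^i u` (`i < n`, `u ∈ N`); then `σ^{2i} ∈ N` (`c² = 1`, `N`
  normal), and `hinj` forces `2i ∈ {0, n}`; `i = 0` would put `c` in `N`.
* (§3, the computation) With `u₀ := σ^{-k} c ∈ N` (trivial on `X` as `c` and `σ` are): `c² = 1` reads
  `(σ^{-k} u₀ σ^k)·u₀ = σ^{-n}`, hence, conjugating by `σ^i`, `u₀^{(k+i)}·u₀^{(i)} = σ^{-n}` where `u^{(j)} := σ^{-j} u σ^j`;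
  the cocycle identity on `N` (all these elements act trivially) and `y(σ^{-n}) = -σ^{-n} y(σ^n) = 0` give
  `y(u₀^{(k+i)}) = -y(u₀^{(i)}) = y(u₀^{(i)})` (`2X = 0`). Therefore
  `Φ(u₀) = Σ_{i<k} (i + (k+i)) • y(u₀^{(i)}) = Σ_{i<k} k • y(u₀^{(i)})` and `Φ(c) = Φ(σ^k) + σ^k Φ(u₀) = k • Φ(σ) + Φ(u₀)`,
  which VANISHES when `k` is even, i.e. when `4 ∣ n` (§1: `Φ(σ^k) = k • Φ(σ)`). For `k` odd the value is
  `Φ(σ) + Σ_{i<k} y(u₀^{(i)})` («half the norm»), in general non-zero — this is why the `0 < Δ` assembly restricts the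
  Kolyvagin primes to `ℓ ≡ 1 (mod 4)` (brief (P3)).

In the application (`…KolyvaginCocycleNoTransverse.lean`, p661924, and its `0 < Δ` successor): `G = Γ_ℚ`,
`N = Gal(ℚ̄/ℚ(μ_ℓ))`, `n = ℓ − 1`, `σ` a tame inertia generator at `ℓ`, `X = 𝒯_J(E)` at `p = 2`, and `c` a complex
conjugation: `c ∉ N` (`ℓ` odd), `c² = 1`, and at `0 < Δ(E)` `c` acts trivially on `𝒯_J(E)` (slotwise on `E[2]` by
`SteinbergFibreAtTwo.smul_eq_self_of_isComplexConjugation_of_Δ_pos`, p686322; `c ∈ ker κ`). Then `Φ(c) = 0` says that the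
localisation of the Kolyvagin class (and of its shifts `S^k Φ`, whose values are `S^k` of those of `Φ`) at the real place
vanishes — the hypothesis `hxinf` of `StepFour.convCoeff_eq_zero_of_qTermIdentity_modPTwist_two_of_xinf` (p685843).

References: K. Rubin, *Euler Systems* (2000) §4.4 (Def. 4.4.1, 4.4.4, Lemma 4.4.2) [Rubin2000]; B. Perrin-Riou, Ann. Inst.
Fourier 48 (1998) §3.1.2 [PerrinRiou1998AIF]; B. Mazur, K. Rubin, Mem. AMS 799 (2004) §3, §5.3 [MazurRubin2004];
J.-P. Serre, *Galois Cohomology* (1997) I §5.1 [SerreGaloisCohomology1997]; tree `…X9KolyvaginClassTwist.lean` (k6-g3),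
`…KolyvaginCocycleNoTransverse.lean` (p661924), lead's `STUB-BRIEF-stub_coreA_posDisc.md` (P2) + ADDENDUM.
-/

-- the summit and its single problem are both named `BirchSwinnertonDyer` (registry layout D-0017)
set_option linter.dupNamespace false
set_option autoImplicit false

noncomputable section

open CategoryTheory Function Finset
open Literature.NumberTheory.GaloisRepresentations
open Literature.NumberTheory.EllipticCurves (subgroupConj subgroupConj_apply_coe subgroupConj_one subgroupConj_comp)
open Summit.BirchSwinnertonDyer.Rank1Residual.GaloisImage
open Summit.BirchSwinnertonDyer.Rank1Residual.GaloisImage.Derivative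

universe u v

namespace Summit.BirchSwinnertonDyer.BirchSwinnertonDyer.Rank1Residual.KolyvaginTwist

variable {R : Type v} [CommRing R] [TopologicalSpace R]
variable {G : Type u} [Group G] [TopologicalSpace G] [IsTopologicalGroup G]
variable (X : TopRep.{u} R G) (N : Subgroup G) [N.Normal]

/-! ### §1 Cocycle values at the powers of a trivially acting element; trivially acting elements -/

omit [IsTopologicalGroup G] in
/-- **`Φ(σ^i) = i • Φ(σ)`** for a continuous crossed homomorphism `Φ` and `σ` acting trivially on `X`
(`Φ(σ^{i+1}) = Φ(σ^i) + σ^i Φ(σ)`). [cite: SerreGaloisCohomology1997, I §5.1] -/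
theorem apply_pow_eq_nsmul_of_rho_eq (Φ : contOneCocycles X) {σ : G} (hσ : ∀ w : X, X.ρ σ w = w)
    (i : ℕ) : Φ.1 (σ ^ i) = i • Φ.1 σ := by
  induction i with
  | zero => rw [pow_zero, contOneCocycles.apply_one, zero_smul]
  | succ i ih => rw [pow_succ, Φ.2, rho_pow_apply_of_rho_eq X hσ, ih, succ_nsmul]

omit [TopologicalSpace G] [IsTopologicalGroup G] in
/-- The inverse of an element acting trivially acts trivially. [folklore] -/
theorem rho_inv_apply_of_rho_eq {g : G} (hg : ∀ w : X, X.ρ g w = w) (w : X) : X.ρ g⁻¹ w = w := by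
  conv_lhs => rw [← hg w]
  exact ρ_inv_apply_ρ_apply X g w

omit [TopologicalSpace G] [IsTopologicalGroup G] in
/-- A product of two elements acting trivially acts trivially. [folklore] -/
theorem rho_mul_apply_of_rho_eq {g h : G} (hg : ∀ w : X, X.ρ g w = w) (hh : ∀ w : X, X.ρ h w = w)
    (w : X) : X.ρ (g * h) w = w := by
  rw [ρ_mul_apply, hh, hg]

/-- The `σ^j`-conjugate `σ^{-j} u σ^j` of an element `u ∈ N` acting trivially acts trivially, when `σ` acts trivially.
[folklore] -/
theorem rho_subgroupConj_pow_apply_of_rho_eq {σ : G} (hσ : ∀ w : X, X.ρ σ w = w) {u : N}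
    (hu : ∀ w : X, X.ρ (u : G) w = w) (j : ℕ) (w : X) :
    X.ρ ((subgroupConj N (σ ^ j) u : N) : G) w = w := by
  rw [subgroupConj_apply_coe]
  exact rho_mul_apply_of_rho_eq X
    (rho_mul_apply_of_rho_eq X (rho_inv_apply_of_rho_eq X (rho_pow_apply_of_rho_eq X hσ j)) hu)
    (rho_pow_apply_of_rho_eq X hσ j) w

/-! ### §2 The index of an involution outside `N`: `c ∈ σ^{n/2} N` -/

omit [TopologicalSpace G] [IsTopologicalGroup G] in
/-- **An involution outside `N` sits in the coset `σ^{n/2} N`.** If the powers `σ^i` (`i < n`) are pairwise incongruent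
modulo the normal subgroup `N` (`hinj`) and `σ^n ∈ N`, then for `c ∉ N` with `c² = 1` and `c ∈ σ^i N` (`i < n`) one
has `2i = n`: indeed `σ^{2i} ≡ c² = 1`, so `2i ∈ {0, n}` by `hinj`, and `i = 0` would put `c` in `N`. (In the application
`G/N = Gal(ℚ(μ_ℓ)/ℚ) ≅ (ℤ/ℓ)ˣ` and complex conjugation is `-1 = σ̄^{(ℓ-1)/2}`.) [folklore] -/
theorem two_mul_eq_of_mul_self_eq_one_of_not_mem {σ c : G} {n : ℕ} (hσn : σ ^ n ∈ N)
    (hinj : ∀ i₁ < n, ∀ i₂ < n, (σ ^ i₁)⁻¹ * σ ^ i₂ ∈ N → i₁ = i₂)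
    {i : ℕ} (hi : i < n) (hic : (σ ^ i)⁻¹ * c ∈ N) (hcc : c * c = 1) (hcN : c ∉ N) : 2 * i = n := by
  -- `σ^{2i} ∈ N`: `σ^{2i} = σ^i (u σ^i u) u⁻¹ … ` with `u = σ^{-i} c`; concretely `σ^i σ^i = (c u⁻¹)(c u⁻¹)` and
  -- `c u⁻¹ c = c (u⁻¹) c ∈ c N c = N c c = N` modulo bookkeeping — we argue with the normal subgroup directly.
  have hu : c = σ ^ i * ((σ ^ i)⁻¹ * c) := by rw [mul_inv_cancel_left]
  set u : G := (σ ^ i)⁻¹ * c with hu_def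
  have h2i : σ ^ (2 * i) ∈ N := by
    -- `σ^i u σ^i u = 1` ⇒ `σ^{2i} = σ^i σ^i = (u σ^i u)⁻¹… `; use: `σ^{2i} = (σ^i u σ^i u) * (u⁻¹ * (σ^i)⁻¹ * u⁻¹ * σ^i)`
    have hcc' : σ ^ i * u * (σ ^ i * u) = 1 := by rw [← hu]; exact hcc
    -- `(σ^i)⁻¹ u⁻¹ σ^i ∈ N` (normality) and `u⁻¹ ∈ N`
    have h1 : (σ ^ i)⁻¹ * u⁻¹ * (σ ^ i)⁻¹⁻¹ ∈ N := ‹N.Normal›.conj_mem _ (N.inv_mem hic) _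
    rw [inv_inv] at h1
    -- `σ^{2i} = σ^i * σ^i = σ^i * (u * σ^i * u * u⁻¹ * (σ^i)⁻¹ * u⁻¹ * σ^i)`… simpler: from `hcc'`,
    -- `σ^i * u * σ^i = u⁻¹`, so `σ^i * σ^i = σ^i * (u⁻¹ * (σ^i * u * σ^i)⁻¹ …)`; we just compute in the group.
    have key : σ ^ (2 * i) = (σ ^ i * u * (σ ^ i * u)) * (u⁻¹ * ((σ ^ i)⁻¹ * u⁻¹ * σ ^ i)) := by
      rw [two_mul, pow_add]; group
    rw [key, hcc', one_mul]
    exact N.mul_mem (N.inv_mem hic) h1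
  by_cases hlt : 2 * i < n
  · -- `2i < n` and `σ^{2i} ∈ N` force `2i = 0`, i.e. `c = u ∈ N`: contradiction
    exfalso
    have h0 : 0 = 2 * i := hinj 0 (by omega) (2 * i) hlt (by rwa [pow_zero, inv_one, one_mul])
    have hi0 : i = 0 := by omega
    apply hcN
    rw [hu, hi0, pow_zero, one_mul]
    exact hic
  · -- `n ≤ 2i < 2n`: `σ^{2i-n} ∈ N` with `2i - n < n` forces `2i - n = 0`
    have hle : n ≤ 2 * i := Nat.le_of_not_lt hlt
    have hsub : σ ^ (2 * i - n) ∈ N := by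
      have h := N.mul_mem h2i (N.inv_mem hσn)
      rwa [← pow_sub _ hle] at h
    have h0 : 0 = 2 * i - n :=
      hinj 0 (by omega) (2 * i - n) (by omega) (by rwa [pow_zero, inv_one, one_mul])
    omega

/-! ### §3 The vanishing of the Kolyvagin cocycle at a trivially acting involution of index `n/2`, `4 ∣ n` -/

/-- **Core computation.** `2·X = 0`; `σ` acts trivially, `σ^{2k} ∈ N`, `y(σ^{2k}) = 0`; `u₀ ∈ N` acts trivially and
`(σ^k u₀)² = 1`; `Φ` extends the derivative cocycle `Σ_{i<2k} i • σ^i·y` of `y`. THEN, if `k` is even,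
`Φ(σ^k u₀) = 0`. Proof: `u₀^{(k+i)}·u₀^{(i)} = σ^{-2k}` (`u^{(j)} = σ^{-j}uσ^j`), so `y(u₀^{(k+i)}) = y(u₀^{(i)})`
(cocycle identity, trivial actions, `y(σ^{-2k}) = 0`, `2X = 0`); hence `Φ(u₀) = Σ_{i<k} (2i + k) • y(u₀^{(i)}) = 0` and
`Φ(σ^k u₀) = k • Φ(σ) + Φ(u₀) = 0`. [cite: Rubin2000, Def. 4.4.1 and Lemma 4.4.2]
[cite: MazurRubin2004, §3 (the derivative construction)] -/
theorem kolyvaginCocycle_apply_pow_mul_eq_zero_of_even (hX2 : ∀ w : X, (2 : ℕ) • w = 0)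
    {σ : G} (hσ : ∀ w : X, X.ρ σ w = w) {k : ℕ} (hk : Even k) (hσn : σ ^ (2 * k) ∈ N)
    (y : contOneCocycles (subgroupRep X N)) (hyσ : y.1 ⟨σ ^ (2 * k), hσn⟩ = 0)
    {u₀ : N} (hu₀ : ∀ w : X, X.ρ (u₀ : G) w = w) (hrel : σ ^ k * u₀ * (σ ^ k * u₀) = 1)
    (Φ : contOneCocycles X)
    (hΦN : ∀ u : N, Φ.1 u =
      ∑ i ∈ range (2 * k), (i : ℤ) • X.ρ (σ ^ i) (y.1 (subgroupConj N (σ ^ i) u))) :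
    Φ.1 (σ ^ k * u₀) = 0 := by
  -- abbreviations: the conjugates `u₀^{(j)}` and their `y`-values
  set v : ℕ → N := fun j => subgroupConj N (σ ^ j) u₀ with hv
  -- (a) every `u₀^{(j)}` acts trivially
  have hvρ : ∀ (j : ℕ) (w : X), X.ρ ((v j : N) : G) w = w := fun j w =>
    rho_subgroupConj_pow_apply_of_rho_eq X N hσ hu₀ j w
  -- (b) `2·w = 0` bookkeeping: `-w = w`, `(m : ℤ) • w` depends on `m` mod `2`
  have hneg : ∀ w : X, -w = w := fun w => by
    rw [neg_eq_iff_add_eq_zero, ← two_nsmul]; exact hX2 w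
  have hk0 : ∀ w : X, (k : ℤ) • w = 0 := fun w => by
    obtain ⟨m, rfl⟩ := hk
    rw [natCast_zsmul, ← two_mul, mul_comm, mul_nsmul', hX2, smul_zero]
  -- (c) the group identity `u₀^{(k+i)} * u₀^{(i)} = σ^{-2k}` in `N`
  have hprod : ∀ i : ℕ, ((v (k + i) * v i : N) : G) = (σ ^ (2 * k))⁻¹ := by
    intro i
    rw [Subgroup.coe_mul, hv, subgroupConj_apply_coe, subgroupConj_apply_coe]
    -- `σ^{-(k+i)} u₀ σ^{k+i} σ^{-i} u₀ σ^i = σ^{-i} (σ^{-k} u₀ σ^k u₀) σ^i = σ^{-i} σ^{-2k} σ^i = σ^{-2k}`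
    have hrel' : (σ ^ k)⁻¹ * (u₀ : G) * σ ^ k * u₀ = (σ ^ (2 * k))⁻¹ := by
      have h : (σ ^ k)⁻¹ * (u₀ : G) * σ ^ k * u₀ = (σ ^ k)⁻¹ * (σ ^ k)⁻¹ * (σ ^ k * u₀ * (σ ^ k * u₀)) := by
        group
      rw [h, hrel, mul_one, ← mul_inv_rev, ← pow_add, two_mul]
    calc (σ ^ (k + i))⁻¹ * (u₀ : G) * σ ^ (k + i) * ((σ ^ i)⁻¹ * u₀ * σ ^ i)
        = (σ ^ i)⁻¹ * ((σ ^ k)⁻¹ * (u₀ : G) * σ ^ k * u₀) * σ ^ i := by rw [pow_add]; group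
      _ = (σ ^ i)⁻¹ * (σ ^ (2 * k))⁻¹ * σ ^ i := by rw [hrel']
      _ = (σ ^ (2 * k))⁻¹ := by group
  -- (d) `y(σ^{-2k}) = 0`
  have hyinv : ∀ i : ℕ, y.1 (v (k + i) * v i) = 0 := by
    intro i
    have hmem : v (k + i) * v i = (⟨σ ^ (2 * k), hσn⟩ : N)⁻¹ := Subtype.ext (by rw [hprod]; rfl)
    rw [hmem, subgroup_cocycle_inv, hyσ, map_zero, neg_zero]
  -- (e) periodicity `y(u₀^{(k+i)}) = y(u₀^{(i)})`
  have hper : ∀ i : ℕ, y.1 (v (k + i)) = y.1 (v i) := by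
    intro i
    have h := subgroup_cocycle_mul X N y (v (k + i)) (v i)
    rw [hyinv i, hvρ] at h
    -- `0 = y(v(k+i)) + y(v i)` ⇒ `y(v(k+i)) = - y(v i) = y(v i)`
    rw [← hneg (y.1 (v i))]
    exact eq_neg_of_add_eq_zero_left h.symm
  -- (f) the derivative sum at `u₀`: drop the trivial `σ^i`, split `range (2k) = range k ∪ (k + range k)`
  have hsum : Φ.1 u₀ = 0 := by
    rw [hΦN u₀]
    have hterm : ∀ i : ℕ, (i : ℤ) • X.ρ (σ ^ i) (y.1 (subgroupConj N (σ ^ i) u₀)) = (i : ℤ) • y.1 (v i) :=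
      fun i => by rw [rho_pow_apply_of_rho_eq X hσ]
    simp_rw [hterm]
    rw [two_mul, Finset.sum_range_add]
    simp_rw [hper, ← Finset.sum_add_distrib, ← add_smul]
    refine Finset.sum_eq_zero fun i _ => ?_
    have hcoef : ((i : ℤ) + ((k + i : ℕ) : ℤ)) • y.1 (v i) = (k : ℤ) • y.1 (v i) := by
      rw [← Nat.cast_add, natCast_zsmul, natCast_zsmul, show i + (k + i) = 2 * i + k by ring, add_nsmul,
        mul_nsmul', hX2, zero_add]
    rw [hcoef, hk0]
  -- (g) `Φ(σ^k u₀) = Φ(σ^k) + σ^k Φ(u₀) = k • Φ(σ) + Φ(u₀) = 0`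
  rw [Φ.2, hsum, map_zero, add_zero, apply_pow_eq_nsmul_of_rho_eq X Φ hσ, ← natCast_zsmul, hk0]

/-- **THE KOLYVAGIN COCYCLE VANISHES AT EVERY TRIVIALLY ACTING INVOLUTION OUTSIDE `N` WHEN `4 ∣ n`** (brief (P2), cocycle
level). In the setting of `exists_kolyvaginCocycle` — `σ` trivial on `X`, `σ^n ∈ N`, the `σ^i` (`i < n`) representing
`G ⧸ N` (`hcov`, `hinj`), `y` a cocycle on `N` with `y(σ^n) = 0`, `Φ|_N` the derivative cocycle of `y` (`hΦN`) — assume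
`2·X = 0` and `4 ∣ n`. Then `Φ(c) = 0` for every `c ∈ G` with `c² = 1`, `c ∉ N`, `c` trivial on `X`. (§2: `c = σ^{n/2} u₀`;
§3.) In the line: `X = 𝒯_J(E)` (`p = 2`), `n = ℓ − 1` with `ℓ ≡ 1 (mod 4)`, `c` = complex conjugation at `0 < Δ(E)`.
[cite: Rubin2000, Def. 4.4.4 and Lemma 4.4.2] [cite: MazurRubin2004, §3 (the derivative construction)] -/
theorem kolyvaginCocycle_apply_eq_zero_of_mul_self_eq_one (hX2 : ∀ w : X, (2 : ℕ) • w = 0)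
    {σ : G} (hσ : ∀ w : X, X.ρ σ w = w) {n : ℕ} (h4 : 4 ∣ n) (hσn : σ ^ n ∈ N)
    (hcov : ∀ g : G, ∃ i < n, (σ ^ i)⁻¹ * g ∈ N)
    (hinj : ∀ i₁ < n, ∀ i₂ < n, (σ ^ i₁)⁻¹ * σ ^ i₂ ∈ N → i₁ = i₂)
    (y : contOneCocycles (subgroupRep X N)) (hyσ : y.1 ⟨σ ^ n, hσn⟩ = 0)
    (Φ : contOneCocycles X)
    (hΦN : ∀ u : N, Φ.1 u = ∑ i ∈ range n, (i : ℤ) • X.ρ (σ ^ i) (y.1 (subgroupConj N (σ ^ i) u)))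
    {c : G} (hcc : c * c = 1) (hcN : c ∉ N) (hc : ∀ w : X, X.ρ c w = w) : Φ.1 c = 0 := by
  obtain ⟨i, hi, hic⟩ := hcov c
  have h2i : 2 * i = n := two_mul_eq_of_mul_self_eq_one_of_not_mem N hσn hinj hi hic hcc hcN
  subst h2i
  -- `k = i` is even since `4 ∣ 2i`
  have hk : Even i := by
    obtain ⟨m, hm⟩ := h4
    exact ⟨m, by omega⟩
  -- `u₀ := σ^{-i} c ∈ N`, trivial on `X`, with `(σ^i u₀)² = c² = 1`
  have hu₀ρ : ∀ w : X, X.ρ (((⟨(σ ^ i)⁻¹ * c, hic⟩ : N) : N) : G) w = w := fun w =>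
    rho_mul_apply_of_rho_eq X (rho_inv_apply_of_rho_eq X (rho_pow_apply_of_rho_eq X hσ i)) hc w
  have hc' : σ ^ i * (((⟨(σ ^ i)⁻¹ * c, hic⟩ : N) : N) : G) = c := mul_inv_cancel_left _ _
  have hrel : σ ^ i * (((⟨(σ ^ i)⁻¹ * c, hic⟩ : N) : N) : G) *
      (σ ^ i * (((⟨(σ ^ i)⁻¹ * c, hic⟩ : N) : N) : G)) = 1 := by rw [hc']; exact hcc
  rw [← hc']
  exact kolyvaginCocycle_apply_pow_mul_eq_zero_of_even X N hX2 hσ hk hσn y hyσ hu₀ρ hrel Φ hΦN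

end Summit.BirchSwinnertonDyer.BirchSwinnertonDyer.Rank1Residual.KolyvaginTwist

end
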